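/-
Copyright: cell `pub-ymgap` (HUMAN RULING D-0062), Track A of `YM-PLAN.md`, DAG node N20 (= NE7b); R134 acceleration seat
`pub-ymgap-dag-n20-c` (strategy s1, generation 4), module 23.  Released under the licence of the surrounding project.
-/
import Summits.QuantumFields.YangMills.Theorems.BalabanUVNodesN20LCSLargeFieldOfMoments
import Summits.QuantumFields.YangMills.Theorems.BalabanUVNodesN20LCSLargeFieldHalves
import HarnessLib

/-!
# YM-DAG node N20 (= NE7b), strategy s1, module 23: SUB-FAMILIES OF THE PINNED LABELS under the displayed POSITIVITY of the residual
# fluctuation factor — the form a key-pattern consumer reads (the pattern pins SOME of the labels whose new large-field family contains `D`)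

Track A of `YM-PLAN.md` (cell `pub-ymgap`, HUMAN RULING D-0062), node **N20** = spine estimate NE7b (`T4WeightBudget.RelWeightBound` — NOT PRINTED,
NOT PROVED).  Seat `pub-ymgap-dag-n20-c` (R134, s1), generation 4, module 23 (17–22 = `…N20LCSLargeField{Labels,FirstStep,Families,Halves,OfMoments}`,
`…N20LCSLabelPieces`).  Kernel theorems only: 0 `def`, 0 `sorry`, standard axioms; COUNT-NEUTRAL; `--supports` the K3‴ item.  Nothing of Bałaban's is
asserted.

WHY.  The (α)-road pins, at a step `j` after the prefix `g`, the KEY PATTERN `keyPattern … j g ⊆ branch j g` — the admissible next choices through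
which some history of the bad key's fibre passes (`Spine/NE7b/KeyPatternReading`); under the causal identification (J2a) these are, for a label-indexed
instance, SOME of the labels whose new large-field family contains the key's cells `D`, not all of them.  Modules 17–22 bound the sum over ALL such
labels; with a SIGNED residual factor `ζ` (def-T displays only `Σ|ζ| ≤ 1`) a sub-sum is not controlled by the full sum.  Print's `ζ_{k+1}(R,S)` is a
`{0,1}`-valued product of characteristic functions ([Balaban1988Convergent] (3.16) p. 268, (3.20)–(3.21) p. 269), so `0 ≤ ζ` is a faithful DISPLAYED
letter (`hζ0`, to be discharged with `IsZetaUnity`∕`IsZetaAbsLeOne` when the minimiser of (3.10) has a body).  THIS FILE, modulo `hζ0`: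
* §1 `ωOfRecord_nonneg`; ★ **`sum_ωOfRecord_sub_le`** — for EVERY finite set `E` of labels pinning `D` (`∀ t ∈ E, D ⊆ P(t)`):
  `0 ≤ Σ_{t∈E} ω s t (U,V′) ≤ Π_{c∈D}(1 − χ_{k+1}(c)(V′))`; `abs_sum_ωOfRecord_sub_le_indicator` (under the letters, `≤ 𝟙[∀ c∈D, ∃ p′∈R c, …]`);
* §2 `abs_integral_mul_le_setIntegral_of_le_indicator` (generic graph step for ANY kernel dominated by the indicator of a measurable coarse event) and
  ★ `abs_integral_sum_sub_mul_le` (sub-family against any old piece `f ≥ 0`, any step);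
* §3 the three readings for sub-families: ★★ **`abs_integral_pinnedSubfamily_rhoZero_le`** (first step: `(m·e^{Cδ₀ − δ₀g₀⁻²ε″²∕(2N)})^{#D}·∫ρ₀`),
  ★★ **`abs_integral_pinnedSubfamily_le_of_moments`** (any performed step, from «LCS-k» in the old term's state, module 22's constants), ★★★
  **`halves_one_of_record_sub`** (`PointwiseExtraction T S 1 χ M a ∧ LocCondStability T S 1 μ ρ₀ M b` at cutoff `1` with the SUB-FAMILY reading
  `hread : Σ_{q ∈ branch 0 g ∩ S 0 g} χ 0 g q U = Σ_{t ∈ E g} ω s t (U,Ū)`, `E g` pinning `D` — (J2a)'s shape for a label-indexed instance).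

HONEST FRAMING.  As modules 17–22 plus ONE more displayed letter (`0 ≤ ζ`, print-true, not discharged); label-indexed; disjoint letter regions; the
identification (J2a) «the key pattern's labels pin the key's cells» is the instance's (RR-1 ∕ (A1c)), stated here as the hypothesis `hE`∕`hread`;
«LCS-j» at `j ≥ 1` untouched.  NE7b NOT PRINTED ∕ NOT PROVED; (α)-instance 0∕1; N20 NOT discharged; typed 28∕28, discharged count untouched; one finite
four-torus at fixed `ε` — NOT ℝ⁴, NOT infinite volume, NOT OS, NOT a mass gap, NOT Clay.

References: T. Bałaban, CMP 119 (1988) 243–285 [Balaban1988Convergent] ((3.2) p. 265, (3.16) p. 268, (3.20)–(3.21) p. 269); CMP 122 (1989) 175–202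
[Balaban1989LargeFieldI] ((0.1) p. 175, (1.22)–(1.28) pp. 181–183); CMP 122 (1989) 355–392 [Balaban1989LargeFieldII] ((1.79)–(1.80) pp. 383–384);
CMP 102 (1985) 277–309 [Balaban1985Variational] (Thm 1 p. 279).
-/

set_option autoImplicit false

noncomputable section

open scoped BigOperators

namespace Summit.QuantumFields.YangMills.BalabanUVNodes.N20LCSLargeFieldSubfamilies

open MeasureTheory
open Literature.MathematicalPhysics.QuantumFieldTheory.Balaban1983to89
open Literature.MathematicalPhysics.QuantumFieldTheory.Balaban1983to89.T4Continuum
open Literature.MathematicalPhysics.QuantumFieldTheory.Balaban1983to89.Node00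
open ExpMeanLog (deltaSU)
open Summit.QuantumFields.BalabanUV.T4Continuum.B16HistoryIndexedRepr (GoodClass)
open Summit.QuantumFields.BalabanUV.T4Continuum.B16HistoryReprChain (Tower)
open Summit.QuantumFields.BalabanUV.T4Continuum.NE7b.LocalConditionalStability (LocCondStability PointwiseExtraction)
open Summit.QuantumFields.YangMills.BalabanUVNodes.N20LCSLargeFieldFirstStep (setIntegral_rhoZeroOfRecord)
open Summit.QuantumFields.YangMills.BalabanUVNodes.N20LCSLargeFieldFamilies
  (abs_sum_ωOfRecord_filter_superset_le prod_one_sub_chiFactor_le_indicator measurableSet_forall_exists_largeField)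
open Summit.QuantumFields.YangMills.BalabanUVNodes.N20LCSLargeFieldHalves (integral_exp_mul_indicator_rhoZero_le)
open Summit.QuantumFields.YangMills.BalabanUVNodes.N20LCSLabelPieces (integral_labelPiece integrable_labelFine)
open Summit.QuantumFields.YangMills.BalabanUVNodes.N20LCSLargeFieldOfMoments (setIntegral_forall_exists_le_of_moments)
open Summit.QuantumFields.YangMills.BalabanUVNodes.N20LCSAvgExpMoment (sq_div_le_one_sub_reTr_of_le_dist1)

variable (F : T4Family) (N : ℕ) [NeZero N] (ν : Stage7Numerics) (M : ℕ) (p : B12.RunParams) (g : ℕ → ℝ)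

/-! ## §1 Positive labels: sub-sums of the pinned family are sandwiched between `0` and the product of complement factors -/

section Pointwise

variable (k : ℕ)

/-- Under the displayed POSITIVITY of the residual fluctuation factor (`0 ≤ ζ`; print: the (3.16)·(3.20)·(3.21) factors are `{0,1}`-valued products
of characteristic functions), every label weight of record is non-negative: `0 ≤ ω s t (U,V′)`. [folklore] -/
theorem ωOfRecord_nonneg (A₁ : ℝ) {ζ : ZetaOfRecord F N ν M}
    (hζ0 : ∀ q g' k' (s : SeqOfRecord F ν M g' q.K k') Pl Ql RS U V', 0 ≤ ζ q g' k' s Pl Ql RS U V')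
    (s : SeqOfRecord F ν M g p.K k) (t : LbOfRecord F ν p g k)
    (U : GaugeField (F.P p.K) k (SU N)) (V' : GaugeField (F.P p.K) (k + 1) (SU N)) :
    0 ≤ ωOfRecord F N ν M p g k A₁ ζ s t U V' :=
  mul_nonneg (mul_nonneg (aWeight_nonneg F N ν M p g k s t.1 V') (bWeight_nonneg F N ν M p g k A₁ s t.1 t.2.1 U V'))
    (hζ0 p g k s t.1 t.2.1 t.2.2 U V')

/-- **SUB-FAMILIES OF THE PINNED LABELS** (the key-pattern consumer's form): modulo `IsZetaAbsLeOne` and `0 ≤ ζ`, for EVERY finite set `E` of labels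
all of whose new large-field families contain `D`, `0 ≤ Σ_{t∈E} ω s t (U,V′) ≤ Π_{c∈D} (1 − χ_{k+1}(c)(V′))`. [folklore] -/
theorem sum_ωOfRecord_sub_le (A₁ : ℝ) {ζ : ZetaOfRecord F N ν M} (hζ : IsZetaAbsLeOne F N ν M ζ)
    (hζ0 : ∀ q g' k' (s : SeqOfRecord F ν M g' q.K k') Pl Ql RS U V', 0 ≤ ζ q g' k' s Pl Ql RS U V')
    (s : SeqOfRecord F ν M g p.K k) (D : Finset (Iχ F ν p g k)) (E : Finset (LbOfRecord F ν p g k)) (hE : ∀ t ∈ E, D ⊆ t.1)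
    (U : GaugeField (F.P p.K) k (SU N)) (V' : GaugeField (F.P p.K) (k + 1) (SU N)) :
    0 ≤ ∑ t ∈ E, ωOfRecord F N ν M p g k A₁ ζ s t U V' ∧
      ∑ t ∈ E, ωOfRecord F N ν M p g k A₁ ζ s t U V' ≤ ∏ c ∈ D, (1 - chiFactor F N ν p g k c V') := by
  classical
  refine ⟨Finset.sum_nonneg fun t _ => ωOfRecord_nonneg F N ν M p g k A₁ hζ0 s t U V', ?_⟩
  have hsub : E ⊆ Finset.univ.filter (fun t : LbOfRecord F ν p g k => D ⊆ t.1) := fun t ht =>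
    Finset.mem_filter.2 ⟨Finset.mem_univ t, hE t ht⟩
  exact (Finset.sum_le_sum_of_subset_of_nonneg hsub fun t _ _ => ωOfRecord_nonneg F N ν M p g k A₁ hζ0 s t U V').trans
    ((le_abs_self _).trans (abs_sum_ωOfRecord_filter_superset_le F N ν M p g k A₁ hζ s D U V'))

/-- The sub-family sum under the regularity letters: `|Σ_{t∈E} ω s t (U,V′)| ≤ 𝟙[∀ c∈D, ∃ p′∈R c, ε″ ≤ |V′(∂p′)−1|]`. [folklore] -/
theorem abs_sum_ωOfRecord_sub_le_indicator (A₁ : ℝ) {ζ : ZetaOfRecord F N ν M} (hζ : IsZetaAbsLeOne F N ν M ζ)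
    (hζ0 : ∀ q g' k' (s : SeqOfRecord F ν M g' q.K k') Pl Ql RS U V', 0 ≤ ζ q g' k' s Pl Ql RS U V')
    (s : SeqOfRecord F ν M g p.K k) (D : Finset (Iχ F ν p g k)) (E : Finset (LbOfRecord F ν p g k)) (hE : ∀ t ∈ E, D ⊆ t.1)
    (R : Iχ F ν p g k → Finset (Plaq (F.P p.K) (k + 1))) (ε'' : ℝ)
    (hreg : ∀ c ∈ D, ∀ V' : GaugeField (F.P p.K) (k + 1) (SU N),
      (∀ p' ∈ R c, dist1 (GaugeField.plaqHol V' p') < ε'') → chiFactor F N ν p g k c V' = 1)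
    (U : GaugeField (F.P p.K) k (SU N)) (V' : GaugeField (F.P p.K) (k + 1) (SU N)) :
    |∑ t ∈ E, ωOfRecord F N ν M p g k A₁ ζ s t U V'| ≤
      Set.indicator {V' : GaugeField (F.P p.K) (k + 1) (SU N) | ∀ c ∈ D, ∃ p' ∈ R c, ε'' ≤ dist1 (GaugeField.plaqHol V' p')}
        (fun _ => (1 : ℝ)) V' := by
  obtain ⟨h0, h1⟩ := sum_ωOfRecord_sub_le F N ν M p g k A₁ hζ hζ0 s D E hE U V'
  rw [abs_of_nonneg h0]
  exact h1.trans (prod_one_sub_chiFactor_le_indicator F N ν p g k D R ε'' hreg V')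

end Pointwise

/-! ## §2 On the graph: a kernel dominated by the indicator of a coarse event weighs at most the event's `f`-mass -/

section Graph

variable (k : ℕ)

/-- **GENERIC GRAPH STEP**: a kernel `Ψ(U, V′)` with `|Ψ(U, Ū)| ≤ 𝟙_T(Ū)` for a measurable coarse event `T` weighs, against an integrable `f ≥ 0`, at most
the `f`-mass of `Ū ∈ T`. [folklore] -/
theorem abs_integral_mul_le_setIntegral_of_le_indicator (Ψ : GaugeField (F.P p.K) k (SU N) → GaugeField (F.P p.K) (k + 1) (SU N) → ℝ)
    {T : Set (GaugeField (F.P p.K) (k + 1) (SU N))} (hT : MeasurableSet T)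
    (hΨ : ∀ U, |Ψ U ((avOfRecord F N p.K k).avg U)| ≤ Set.indicator T (fun _ => (1 : ℝ)) ((avOfRecord F N p.K k).avg U))
    {f : GaugeField (F.P p.K) k (SU N) → ℝ} (hf0 : ∀ U, 0 ≤ f U) (hf : Integrable f (fieldMeasure (F.P p.K) k (SU N))) :
    |∫ U, Ψ U ((avOfRecord F N p.K k).avg U) * f U ∂(fieldMeasure (F.P p.K) k (SU N))| ≤
      ∫ U in (avOfRecord F N p.K k).avg ⁻¹' T, f U ∂(fieldMeasure (F.P p.K) k (SU N)) := by
  have hSm : MeasurableSet ((avOfRecord F N p.K k).avg ⁻¹' T) := hT.preimage (avOfRecord_measurable F N p.K k)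
  rw [← integral_indicator hSm, ← Real.norm_eq_abs]
  refine norm_integral_le_of_norm_le (hf.indicator hSm) (ae_of_all _ fun U => ?_)
  rw [Real.norm_eq_abs, abs_mul, abs_of_nonneg (hf0 U)]
  have hind : Set.indicator ((avOfRecord F N p.K k).avg ⁻¹' T) f U = Set.indicator T (fun _ => (1 : ℝ)) ((avOfRecord F N p.K k).avg U) * f U := by
    by_cases hU : (avOfRecord F N p.K k).avg U ∈ T
    · rw [Set.indicator_of_mem (show U ∈ (avOfRecord F N p.K k).avg ⁻¹' T from hU), Set.indicator_of_mem hU, one_mul]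
    · rw [Set.indicator_of_notMem (show U ∉ (avOfRecord F N p.K k).avg ⁻¹' T from hU), Set.indicator_of_notMem hU, zero_mul]
  rw [hind]
  exact mul_le_mul_of_nonneg_right (hΨ U) (hf0 U)

/-- **A PINNED SUB-FAMILY AGAINST ANY NON-NEGATIVE OLD PIECE, ON THE GRAPH** (any step): modulo `IsZetaAbsLeOne`, `0 ≤ ζ` and the letters,
`|∫ (Σ_{t∈E} ω s t (U,Ū))·f dU| ≤ ∫_{∀ c∈D, ∃ p′∈R c, ε″ ≤ |Ū(∂p′)−1|} f dU`. [folklore] -/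
theorem abs_integral_sum_sub_mul_le (A₁ : ℝ) {ζ : ZetaOfRecord F N ν M} (hζ : IsZetaAbsLeOne F N ν M ζ)
    (hζ0 : ∀ q g' k' (s : SeqOfRecord F ν M g' q.K k') Pl Ql RS U V', 0 ≤ ζ q g' k' s Pl Ql RS U V')
    (s : SeqOfRecord F ν M g p.K k) (D : Finset (Iχ F ν p g k)) (E : Finset (LbOfRecord F ν p g k)) (hE : ∀ t ∈ E, D ⊆ t.1)
    (R : Iχ F ν p g k → Finset (Plaq (F.P p.K) (k + 1))) (ε'' : ℝ)
    (hreg : ∀ c ∈ D, ∀ V' : GaugeField (F.P p.K) (k + 1) (SU N),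
      (∀ p' ∈ R c, dist1 (GaugeField.plaqHol V' p') < ε'') → chiFactor F N ν p g k c V' = 1)
    {f : GaugeField (F.P p.K) k (SU N) → ℝ} (hf0 : ∀ U, 0 ≤ f U) (hf : Integrable f (fieldMeasure (F.P p.K) k (SU N))) :
    |∫ U, (∑ t ∈ E, ωOfRecord F N ν M p g k A₁ ζ s t U ((avOfRecord F N p.K k).avg U)) * f U ∂(fieldMeasure (F.P p.K) k (SU N))| ≤
      ∫ U in {U | ∀ c ∈ D, ∃ p' ∈ R c, ε'' ≤ dist1 (GaugeField.plaqHol ((avOfRecord F N p.K k).avg U) p')}, f U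
        ∂(fieldMeasure (F.P p.K) k (SU N)) :=
  abs_integral_mul_le_setIntegral_of_le_indicator F N p k (fun U V' => ∑ t ∈ E, ωOfRecord F N ν M p g k A₁ ζ s t U V')
    (measurableSet_forall_exists_largeField F N ν p g k D R ε'')
    (fun U => abs_sum_ωOfRecord_sub_le_indicator F N ν M p g k A₁ hζ hζ0 s D E hE R ε'' hreg U _) hf0 hf

end Graph

/-! ## §3 The three readings for sub-families: first step, from «LCS-k», and the two halves at cutoff 1 -/

section Readings

/-- **FIRST STEP, SUB-FAMILY**: `|∫ (Σ_{t∈E} ω s t (U,Ū)) ρ₀ dU| ≤ (m·e^{Cδ₀ − δ₀g₀⁻²ε″²∕(2N)})^{#D}·∫ρ₀ dU` for every `E` pinning `D`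
(pairwise disjoint letter regions of `≤ m` plaquettes). [folklore] -/
theorem abs_integral_pinnedSubfamily_rhoZero_le :
    ∃ δ₀ : ℝ, 0 < δ₀ ∧ ∃ C : ℝ, 0 ≤ C ∧ ∀ (_hK : 1 ≤ p.K) (g₀ E₀ : ℝ), 4 * N ≤ g₀⁻¹ ^ 2 →
      ∀ (A₁ : ℝ) {ζ : ZetaOfRecord F N ν M}, IsZetaAbsLeOne F N ν M ζ →
        (∀ q g' k' (s : SeqOfRecord F ν M g' q.K k') Pl Ql RS U V', 0 ≤ ζ q g' k' s Pl Ql RS U V') →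
      ∀ (s : SeqOfRecord F ν M g p.K 0) (D : Finset (Iχ F ν p g 0)) (E : Finset (LbOfRecord F ν p g 0)), (∀ t ∈ E, D ⊆ t.1) →
      ∀ (R : Iχ F ν p g 0 → Finset (Plaq (F.P p.K) 1)) (m : ℕ) (ε'' : ℝ), 0 ≤ ε'' → (∀ c ∈ D, (R c).card ≤ m) →
        (∀ c₁ ∈ D, ∀ c₂ ∈ D, c₁ ≠ c₂ → Disjoint (R c₁) (R c₂)) →
        (∀ c ∈ D, ∀ V' : GaugeField (F.P p.K) 1 (SU N),
          (∀ p' ∈ R c, dist1 (GaugeField.plaqHol V' p') < ε'') → chiFactor F N ν p g 0 c V' = 1) →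
        |∫ U, (∑ t ∈ E, ωOfRecord F N ν M p g 0 A₁ ζ s t U ((avOfRecord F N p.K 0).avg U)) * rhoZeroOfRecord F N p.K g₀ E₀ U
            ∂(fieldMeasure (F.P p.K) 0 (SU N))| ≤
          ((m : ℝ) * Real.exp (C * δ₀ - δ₀ * g₀⁻¹ ^ 2 * (ε'' ^ 2 / (2 * (Fintype.card (Fin N) : ℝ))))) ^ D.card *
            ∫ U, rhoZeroOfRecord F N p.K g₀ E₀ U ∂(fieldMeasure (F.P p.K) 0 (SU N)) := by
  obtain ⟨δ₀, hδ₀, C, hC, h⟩ := integral_exp_mul_indicator_rhoZero_le F N ν p g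
  refine ⟨δ₀, hδ₀, C, hC, fun hK g₀ E₀ hg A₁ ζ hζ hζ0 s D E hE R m ε'' hε hm hdisj hreg => ?_⟩
  have hβ0 : (0 : ℝ) ≤ g₀⁻¹ ^ 2 := sq_nonneg _
  have hρ0 : ∀ U, 0 ≤ rhoZeroOfRecord F N p.K g₀ E₀ U := fun U => (rhoZeroOfRecord_pos F N p.K g₀ E₀ U).le
  have hρi : Integrable (rhoZeroOfRecord F N p.K g₀ E₀) (fieldMeasure (F.P p.K) 0 (SU N)) :=
    (Missing.integrable_boltzmann RegularGaugeGroup.measurable_reTr (F.P p.K) hβ0).const_mul _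
  have h1 := abs_integral_sum_sub_mul_le F N ν M p g 0 A₁ hζ hζ0 s D E hE R ε'' hreg hρ0 hρi
  obtain ⟨_, h2⟩ := h hK g₀ E₀ hg D R m ε'' hε hm hdisj 0
  have hSm : MeasurableSet {U : cfgOfRecord F N p.K 0 |
      ∀ c ∈ D, ∃ p' ∈ R c, ε'' ≤ dist1 (GaugeField.plaqHol ((avOfRecord F N p.K 0).avg U) p')} :=
    (measurableSet_forall_exists_largeField F N ν p g 0 D R ε'').preimage (avOfRecord_measurable F N p.K 0)
  refine h1.trans ?_
  rw [Real.exp_zero, one_mul] at h2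
  rw [← integral_indicator hSm]
  refine le_trans (le_of_eq (integral_congr_ae (ae_of_all _ fun U => ?_))) h2
  show Set.indicator _ (rhoZeroOfRecord F N p.K g₀ E₀) U = (1 * Set.indicator _ (fun _ => (1 : ℝ)) U) * rhoZeroOfRecord F N p.K g₀ E₀ U
  by_cases hU : U ∈ {U : cfgOfRecord F N p.K 0 |
      ∀ c ∈ D, ∃ p' ∈ R c, ε'' ≤ dist1 (GaugeField.plaqHol ((avOfRecord F N p.K 0).avg U) p')}
  · rw [Set.indicator_of_mem hU, Set.indicator_of_mem hU, one_mul, one_mul]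
  · rw [Set.indicator_of_notMem hU, Set.indicator_of_notMem hU, mul_zero, zero_mul]

/-- **FROM «LCS-k», SUB-FAMILY** (any performed step `k < K`): the moment form of «LCS-k» for the old piece `f` gives
`|∫ (Σ_{t∈E} ω s t (U,Ū))·f dU| ≤ (m·e^{C·A·M·M·δ − δβ·ε″²∕(2N)})^{#D}·∫ f dU`. [folklore] -/
theorem abs_integral_pinnedSubfamily_le_of_moments (k : ℕ) (hk : k < p.K) {α : ℝ} (hα : 0 < α)
    (hguard : (((((F.P p.K).d + 2) * (F.P p.K).L : ℕ) : ℝ) ^ 2 / 4) * Real.sqrt (2 * (Fintype.card (Fin N) : ℝ) * α) <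
      deltaSU (Fin N))
    (A₁ : ℝ) {ζ : ZetaOfRecord F N ν M} (hζ : IsZetaAbsLeOne F N ν M ζ)
    (hζ0 : ∀ q g' k' (s : SeqOfRecord F ν M g' q.K k') Pl Ql RS U V', 0 ≤ ζ q g' k' s Pl Ql RS U V')
    (s : SeqOfRecord F ν M g p.K k)
    {f : GaugeField (F.P p.K) k (SU N) → ℝ} (hfm : Measurable f) (hf0 : ∀ U, 0 ≤ f U)
    (hf : Integrable f (fieldMeasure (F.P p.K) k (SU N))) {β : ℝ} (hβ : 0 ≤ β) {C a₀ : ℝ} (hC : 0 ≤ C)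
    (hLS : ∀ a : ℝ, 0 ≤ a → a ≤ a₀ → ∀ X : Finset (Plaq (F.P p.K) k),
      ∫ U, Real.exp (a * β * ∑ q ∈ X, (1 - reTr (GaugeField.plaqHol U q))) * f U ∂(fieldMeasure (F.P p.K) k (SU N)) ≤
        Real.exp (C * a * X.card) * ∫ U, f U ∂(fieldMeasure (F.P p.K) k (SU N)))
    {δ : ℝ} (hδ0 : 0 ≤ δ)
    (hδ : δ * ((2 * (Fintype.card (Fin N) : ℝ) * (((F.P p.K).L : ℝ) ^ 2 + 6 * ((((F.P p.K).d + 2) * (F.P p.K).L : ℕ) : ℝ) ^ 2) ^ 2 + 2 / α) *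
      (((2 * (((F.P p.K).d + 3) * (F.P p.K).L + 2) + 1) ^ (F.P p.K).d * (F.P p.K).d ^ 2 : ℕ) : ℝ)) ≤ a₀)
    (D : Finset (Iχ F ν p g k)) (E : Finset (LbOfRecord F ν p g k)) (hE : ∀ t ∈ E, D ⊆ t.1)
    (R : Iχ F ν p g k → Finset (Plaq (F.P p.K) (k + 1))) (m : ℕ) {ε'' : ℝ} (hε : 0 ≤ ε'')
    (hm : ∀ c ∈ D, (R c).card ≤ m) (hdisj : ∀ c₁ ∈ D, ∀ c₂ ∈ D, c₁ ≠ c₂ → Disjoint (R c₁) (R c₂))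
    (hreg : ∀ c ∈ D, ∀ V' : GaugeField (F.P p.K) (k + 1) (SU N),
      (∀ p' ∈ R c, dist1 (GaugeField.plaqHol V' p') < ε'') → chiFactor F N ν p g k c V' = 1) :
    |∫ U, (∑ t ∈ E, ωOfRecord F N ν M p g k A₁ ζ s t U ((avOfRecord F N p.K k).avg U)) * f U ∂(fieldMeasure (F.P p.K) k (SU N))| ≤
      ((m : ℝ) * Real.exp (C * ((2 * (Fintype.card (Fin N) : ℝ) *
            (((F.P p.K).L : ℝ) ^ 2 + 6 * ((((F.P p.K).d + 2) * (F.P p.K).L : ℕ) : ℝ) ^ 2) ^ 2 + 2 / α) *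
          (((2 * (((F.P p.K).d + 3) * (F.P p.K).L + 2) + 1) ^ (F.P p.K).d * (F.P p.K).d ^ 2 : ℕ) : ℝ)) *
          (((2 * (((F.P p.K).d + 3) * (F.P p.K).L + 2) + 1) ^ (F.P p.K).d * (F.P p.K).d ^ 2 : ℕ) : ℝ) * δ -
            δ * β * (ε'' ^ 2 / (2 * (Fintype.card (Fin N) : ℝ))))) ^ D.card *
        ∫ U, f U ∂(fieldMeasure (F.P p.K) k (SU N)) := by
  classical
  have hj : k + 1 ≤ (F.P p.K).m + (F.P p.K).K := by
    simp only [T4Family.P_m, T4Family.P_K]; omega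
  have h1 := abs_integral_sum_sub_mul_le F N ν M p g k A₁ hζ hζ0 s D E hE R ε'' hreg hf0 hf
  set S : Set (GaugeField (F.P p.K) k (SU N)) :=
    {U | ∀ c ∈ D, ∃ p' ∈ R c, ε'' ≤ dist1 (GaugeField.plaqHol ((avOfRecord F N p.K k).avg U) p')} with hS
  set S' : Set (GaugeField (F.P p.K) k (SU N)) :=
    {U | ∀ c ∈ D, ∃ p' ∈ R c, ε'' ^ 2 / (2 * (Fintype.card (Fin N) : ℝ)) ≤
      1 - reTr (GaugeField.plaqHol (BlockAveraging.avgFun (ExpMeanLog.expMeanLogSU (n := Fin N)) U) p')} with hS'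
  have hsub : S ⊆ S' := by
    intro U hU c hc
    obtain ⟨p', hp', hle⟩ := hU c hc
    exact ⟨p', hp', sq_div_le_one_sub_reTr_of_le_dist1 _ hε hle⟩
  have h2 : ∫ U in S, f U ∂(fieldMeasure (F.P p.K) k (SU N)) ≤ ∫ U in S', f U ∂(fieldMeasure (F.P p.K) k (SU N)) :=
    setIntegral_mono_set hf.integrableOn (ae_of_all _ hf0) (ae_of_all _ hsub)
  have h3 := setIntegral_forall_exists_le_of_moments (N := N) hj hα hguard hfm hf0 hf hβ hC hLS hδ0 hδ
    (ε'' ^ 2 / (2 * (Fintype.card (Fin N) : ℝ))) D R m hm hdisj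
  exact h1.trans (h2.trans h3)

/-- **THE TWO HALVES AT CUTOFF 1, SUB-FAMILY READING** (the key-pattern consumer's `hread`: the pinned level-`0` kernel sum reads the sum over SOME
labels `E g` pinning `D` — (J2a)'s identification for a label-indexed instance): `PointwiseExtraction T S 1 χ M a ∧ LocCondStability T S 1 μ ρ₀ M b`
with the indicator carrier and `e^{a 0 g}·(m·r)^{#D} ≤ e^{b 0 g}`, modulo `IsZetaAbsLeOne`, `0 ≤ ζ` and the letters. [folklore] -/
theorem halves_one_of_record_sub :
    ∃ δ₀ : ℝ, 0 < δ₀ ∧ ∃ C : ℝ, 0 ≤ C ∧ ∀ (_hK : 1 ≤ p.K) (g₀ E₀ : ℝ), 4 * N ≤ g₀⁻¹ ^ 2 →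
      ∀ (A₁ : ℝ) {ζ : ZetaOfRecord F N ν M}, IsZetaAbsLeOne F N ν M ζ →
        (∀ q g' k' (s : SeqOfRecord F ν M g' q.K k') Pl Ql RS U V', 0 ≤ ζ q g' k' s Pl Ql RS U V') →
      ∀ (s : SeqOfRecord F ν M g p.K 0) (D : Finset (Iχ F ν p g 0)) (R : Iχ F ν p g 0 → Finset (Plaq (F.P p.K) 1))
        (m : ℕ) (ε'' : ℝ), 0 ≤ ε'' → (∀ c ∈ D, (R c).card ≤ m) →
        (∀ c₁ ∈ D, ∀ c₂ ∈ D, c₁ ≠ c₂ → Disjoint (R c₁) (R c₂)) →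
        (∀ c ∈ D, ∀ V' : GaugeField (F.P p.K) 1 (SU N),
          (∀ p' ∈ R c, dist1 (GaugeField.plaqHol V' p') < ε'') → chiFactor F N ν p g 0 c V' = 1) →
      ∀ {Pat : Type} [DecidableEq Pat] {𝒢 : (j : ℕ) → GoodClass (cfgOfRecord F N p.K j)}
        (T : Tower Pat (fun j => cfgOfRecord F N p.K j) 𝒢) (S : (j : ℕ) → (Fin j → Pat) → Finset Pat)
        (μ : (j : ℕ) → Measure (cfgOfRecord F N p.K j))
        (χ : (j : ℕ) → (Fin j → Pat) → Pat → cfgOfRecord F N p.K j → ℝ)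
        (Mc : (j : ℕ) → (Fin j → Pat) → cfgOfRecord F N p.K j → ℝ) (a b : (j : ℕ) → (Fin j → Pat) → ℝ)
        (E : (Fin 0 → Pat) → Finset (LbOfRecord F ν p g 0)),
        (∀ h t, t ∈ E h → D ⊆ t.1) →
        μ 0 = fieldMeasure (F.P p.K) 0 (SU N) →
        (∀ (h : Fin 0 → Pat) (U : cfgOfRecord F N p.K 0), ∑ q ∈ T.branch 0 h ∩ S 0 h, χ 0 h q U =
          ∑ t ∈ E h, ωOfRecord F N ν M p g 0 A₁ ζ s t U ((avOfRecord F N p.K 0).avg U)) →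
        (∀ (h : Fin 0 → Pat) (U : cfgOfRecord F N p.K 0), Mc 0 h U = Real.exp (a 0 h) *
          Set.indicator {U : GaugeField (F.P p.K) 0 (SU N) |
            ∀ c ∈ D, ∃ p' ∈ R c, ε'' ≤ dist1 (GaugeField.plaqHol ((avOfRecord F N p.K 0).avg U) p')} (fun _ => (1 : ℝ)) U) →
        (∀ h : Fin 0 → Pat, Real.exp (a 0 h) *
          ((m : ℝ) * Real.exp (C * δ₀ - δ₀ * g₀⁻¹ ^ 2 * (ε'' ^ 2 / (2 * (Fintype.card (Fin N) : ℝ))))) ^ D.card ≤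
            Real.exp (b 0 h)) →
        PointwiseExtraction T S 1 χ Mc a ∧ LocCondStability T S 1 μ (rhoZeroOfRecord F N p.K g₀ E₀) Mc b := by
  obtain ⟨δ₀, hδ₀, C, hC, h⟩ := integral_exp_mul_indicator_rhoZero_le F N ν p g
  refine ⟨δ₀, hδ₀, C, hC,
    fun hK g₀ E₀ hg A₁ ζ hζ hζ0 s D R m ε'' hε hm hdisj hreg Pat _ 𝒢 T S μ χ Mc a b E hE hμ hread hM hb => ⟨?_, ?_⟩⟩
  · intro j gh hj _ U
    obtain rfl : j = 0 := Nat.lt_one_iff.mp hj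
    rw [hread gh U, hM gh U, ← mul_assoc, ← Real.exp_add, neg_add_cancel, Real.exp_zero, one_mul]
    have h1 := (le_abs_self _).trans
      (abs_sum_ωOfRecord_sub_le_indicator F N ν M p g 0 A₁ hζ hζ0 s D (E gh) (hE gh) R ε'' hreg U ((avOfRecord F N p.K 0).avg U))
    refine h1.trans (le_of_eq ?_)
    by_cases hU : ∀ c ∈ D, ∃ p' ∈ R c, ε'' ≤ dist1 (GaugeField.plaqHol ((avOfRecord F N p.K 0).avg U) p')
    · rw [Set.indicator_of_mem (show (avOfRecord F N p.K 0).avg U ∈ {V' : GaugeField (F.P p.K) 1 (SU N) |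
          ∀ c ∈ D, ∃ p' ∈ R c, ε'' ≤ dist1 (GaugeField.plaqHol V' p')} from hU),
        Set.indicator_of_mem (show U ∈ {U : GaugeField (F.P p.K) 0 (SU N) |
          ∀ c ∈ D, ∃ p' ∈ R c, ε'' ≤ dist1 (GaugeField.plaqHol ((avOfRecord F N p.K 0).avg U) p')} from hU)]
    · rw [Set.indicator_of_notMem (show (avOfRecord F N p.K 0).avg U ∉ {V' : GaugeField (F.P p.K) 1 (SU N) |
          ∀ c ∈ D, ∃ p' ∈ R c, ε'' ≤ dist1 (GaugeField.plaqHol V' p')} from hU),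
        Set.indicator_of_notMem (show U ∉ {U : GaugeField (F.P p.K) 0 (SU N) |
          ∀ c ∈ D, ∃ p' ∈ R c, ε'' ≤ dist1 (GaugeField.plaqHol ((avOfRecord F N p.K 0).avg U) p')} from hU)]
  · intro j gh hj _
    obtain rfl : j = 0 := Nat.lt_one_iff.mp hj
    have hMh : Mc 0 gh = fun U => Real.exp (a 0 gh) *
        Set.indicator {U : GaugeField (F.P p.K) 0 (SU N) |
          ∀ c ∈ D, ∃ p' ∈ R c, ε'' ≤ dist1 (GaugeField.plaqHol ((avOfRecord F N p.K 0).avg U) p')} (fun _ => (1 : ℝ)) U :=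
      funext (hM gh)
    show Integrable (fun y => Mc 0 gh y * rhoZeroOfRecord F N p.K g₀ E₀ y) (μ 0) ∧
      ∫ y, Mc 0 gh y * rhoZeroOfRecord F N p.K g₀ E₀ y ∂μ 0 ≤
        Real.exp (b 0 gh) * ∫ y, rhoZeroOfRecord F N p.K g₀ E₀ y ∂μ 0
    rw [hMh, hμ]
    obtain ⟨hint, hle⟩ := h hK g₀ E₀ hg D R m ε'' hε hm hdisj (a 0 gh)
    exact ⟨hint, hle.trans (mul_le_mul_of_nonneg_right (hb gh)
      (integral_nonneg fun U => (rhoZeroOfRecord_pos F N p.K g₀ E₀ U).le))⟩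

end Readings

end Summit.QuantumFields.YangMills.BalabanUVNodes.N20LCSLargeFieldSubfamilies

end
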